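import Summits.CriticalPhenomena.CardyFormulaZ2.Theorems.CardyBondTriangularApproxDiscreteCauchy
import Literature.Probability.Percolation.TriApproxDomain
import Literature.Probability.Percolation.ScaleSelection

/-!
# Route CardyBondTriangular — the switching reduction (support of stmt-CriticalPhenomena-5004)

The formal skeleton of the route's informal support item `SwitchingReduction`
("MesoscopicColourSwitching ∧ the Bollobás–Riordan percolation inputs for critical bond-𝕋 ∧ the
tree's Lemma-14 domains ⇒ the separating data of `SeparatingDataToCardy`, via
`ApproxDiscreteCauchy`"), proved here ONCE for an arbitrary system of face functions, so that
the model-specific work left for bond-𝕋 (in its Chayes–Lei hexagon representation,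
`Literature.Probability.Percolation.ChayesLeiHexPercolation`, separating probabilities
`TriMarkedDomain.clSepProb`; see the companion file `CardyBondTriangularSwitchingReductionFormats`)
is exactly the list of percolation estimates below.

Setting (Bollobás–Riordan, *Percolation* (2006), Ch. 7 §7.2.4–7.2.6). `R` is a conformal
rectangle, `G δ` a discrete approximation of it (`IsDiscreteApprox R G`: the geometry of Lemma 14,
p. 184, with Claim 21 and (31)–(34)), `F δ i w ∈ [0, 1]` a value attached to the face `w` of `δ𝕋`
(for a percolation model: the separating probability `fⁱ_δ(w) = P(Eⁱ_δ(w))`, (9) p. 180, of the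
3-marked domain `(G δ).dropLast`) and `g δ i w z` a value attached to ordered pairs of adjacent
faces (`hⁱ_δ(w, z) = P(Eⁱ_δ(z) ∖ Eⁱ_δ(w))`, p. 180). The hypotheses of
`exists_isSeparatingData_of_approxSwitching` are

* (10) `F(z) - F(w) = g(w, z) - g(z, w)` (exact; additivity of the measure);
* (12) `|g δ i w z| ≤ ε_K(δ) → 0` for the faces with centre in a compact `K ⊆ Ω` (three-arm
  smallness: Claim 10 + the annulus bound, Lemma 4);
* (14≈) **approximate colour switching**: `|g^{i+1}_δ(w, z_{j+1}) - gⁱ_δ(w, z_j)| ≤ η_K(δ)` for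
  the faces in `K`, with a PER-FACE DEFECT `η_K(δ) = o(δ)` — the slot of the route's crux
  `MesoscopicColourSwitching` (for site percolation on `𝕋` this is Lemma 12 with `η = 0`);
* (p. 198) the equicontinuity estimate along short dual chains of triangles of `G_δ`;
* (pp. 200–201) the boundary values on the three open arcs;

and its conclusion is a system of discrete separating data `IsSeparatingData R ω S f` with
`ω = ζ²` (anticlockwise marking), `S_δ` the face centres of `G_δ` and `f_δⁱ` reading `F δ i` at
the face centres. The discrete Cauchy clause is obtained from the route item
`ApproxDiscreteCauchy` (`norm_discreteTriangleIntegral_sub_mul_le_approx`: defect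
`6 n δ ε + 3 n² δ η`); since a contour inside `K ⊆ Ω` has side `n δ ≤ diam Ω`, the defect is
`n δ · (6 ε_K(δ) + 3 diam Ω · η_K(δ)/δ) = n δ · o(1)`, and the compact-dependent rates are made
into the single rate demanded by `IsSeparatingData.cauchy` by a diagonal argument over the
exhaustion `K_m = {z : dist(z, Ωᶜ) ≥ 1/(m+1)}` (`exists_rate_dominating`).

## References

* B. Bollobás, O. Riordan, *Percolation*, Cambridge University Press (2006), Ch. 7: (9)–(10)
  p. 180, Lemmas 12–13 pp. 180–182, Lemma 14 p. 184, §7.2.6 pp. 196–203.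
-/

noncomputable section

namespace Summit.CriticalPhenomena.CardyFormulaZ2.Theorems

open Set Filter Topology Metric
open Literature.Probability.Percolation Literature.Probability.RandomPlanarGeometry
open Literature.Probability.RandomPlanarGeometry.MarkedDomain
open Literature.Probability.LatticeModels

/-! ### Diagonal selection of a dominating rate -/

/-- **A countable family of rates `e_m(δ) → 0` is eventually dominated by a single rate
`E(δ) → 0`**: `e_m ≤ E` eventually as `δ → 0⁺`, for every `m` (diagonal selection: at
precision `ε` only the finitely many `m ≤ 1/ε` are asked to satisfy `e_m(δ) ≤ ε`, and
`exists_scale_tendsto` chooses `ε(δ) → 0`). [folklore] -/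
theorem exists_rate_dominating (e : ℕ → ℝ → ℝ) (he : ∀ m, Tendsto (e m) (𝓝[>] 0) (𝓝 0)) :
    ∃ E : ℝ → ℝ, Tendsto E (𝓝[>] 0) (𝓝 0) ∧ ∀ m, ∀ᶠ δ in 𝓝[>] (0 : ℝ), e m δ ≤ E δ := by
  set P : ℝ → ℝ → Prop := fun ε δ => ∀ m : ℕ, (m : ℝ) ≤ 1 / ε → e m δ ≤ ε with hP
  have hPall : ∀ ε > 0, ∃ δ₀ > 0, ∀ δ, 0 < δ → δ < δ₀ → P ε δ := by
    intro ε hε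
    -- the finitely many `m ≤ ⌈1/ε⌉₊`
    have hfin : ∀ᶠ δ in 𝓝[>] (0 : ℝ), ∀ m ∈ Finset.range (⌈1 / ε⌉₊ + 1), e m δ ≤ ε := by
      rw [Finset.eventually_all]
      intro m _
      exact (he m).eventually (Iic_mem_nhds hε)
    obtain ⟨δ₀, hδ₀, h⟩ := exists_forall_Ioo_of_eventually hfin
    refine ⟨δ₀, hδ₀, fun δ hδ hδlt m hm => h δ ⟨hδ, hδlt⟩ m ?_⟩
    rw [Finset.mem_range]
    have h1 : (m : ℝ) < ⌈1 / ε⌉₊ + 1 := by linarith [Nat.le_ceil (1 / ε)]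
    exact_mod_cast h1
  obtain ⟨E, hE, hEpos, hEP⟩ := exists_scale_tendsto hPall
  refine ⟨E, hE, fun m => ?_⟩
  have hsmall : ∀ᶠ δ in 𝓝[>] (0 : ℝ), E δ < 1 / ((m : ℝ) + 1) := hE (Iio_mem_nhds (by positivity))
  filter_upwards [hEP, hsmall] with δ hPδ hδm
  refine hPδ m ?_
  rw [le_div_iff₀ (hEpos δ)]
  have h1 : E δ * ((m : ℝ) + 1) < 1 := by
    have := (lt_div_iff₀ (show (0 : ℝ) < (m : ℝ) + 1 by positivity)).1 hδm
    linarith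
  nlinarith [hEpos δ]

/-! ### Exhaustion of the domain by the compact sets of deep points -/

/-- The `ρ`-deep points `{z | ρ ≤ dist(z, Ωᶜ)}` of the (bounded, open) domain of a conformal
rectangle form a compact subset of the domain (`ρ > 0`). [folklore] -/
theorem isCompact_deep (R : ConformalRectangle) {ρ : ℝ} (hρ : 0 < ρ) :
    IsCompact {z : ℂ | ρ ≤ infDist z R.carrierᶜ} ∧ {z : ℂ | ρ ≤ infDist z R.carrierᶜ} ⊆ R.carrier := by
  have hsub : {z : ℂ | ρ ≤ infDist z R.carrierᶜ} ⊆ R.carrier := fun z hz => by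
    by_contra h
    have h0 : infDist z R.carrierᶜ = 0 := infDist_zero_of_mem h
    have hz' : ρ ≤ infDist z R.carrierᶜ := hz
    linarith
  exact ⟨Metric.isCompact_of_isClosed_isBounded
    (isClosed_le continuous_const (continuous_infDist_pt _)) (R.isBounded.subset hsub), hsub⟩

/-- Every compact subset of the domain consists of `1/(m+1)`-deep points for some `m`. [folklore] -/
theorem exists_subset_deep (R : ConformalRectangle) {K : Set ℂ} (hK : IsCompact K)
    (hKΩ : K ⊆ R.carrier) : ∃ m : ℕ, K ⊆ {z : ℂ | 1 / ((m : ℝ) + 1) ≤ infDist z R.carrierᶜ} := by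
  rcases K.eq_empty_or_nonempty with rfl | hne
  · exact ⟨0, empty_subset _⟩
  -- the continuous positive function `z ↦ dist(z, Ωᶜ)` has a positive minimum on `K`
  obtain ⟨z₀, hz₀, hmin⟩ := hK.exists_isMinOn hne (continuous_infDist_pt (R.carrierᶜ)).continuousOn
  have hpos : 0 < infDist z₀ R.carrierᶜ := by
    have hne' : (R.carrierᶜ).Nonempty := by
      by_contra h
      rw [not_nonempty_iff_eq_empty, compl_empty_iff] at h
      exact R.carrier_ne_univ h
    rw [← (R.isOpen.isClosed_compl).notMem_iff_infDist_pos hne']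
    exact fun h => h (hKΩ hz₀)
  obtain ⟨m, hm⟩ := exists_nat_one_div_lt hpos
  exact ⟨m, fun z hz => (le_of_lt hm).trans (hmin hz)⟩

/-! ### Reading face values at face centres -/

/-- **A plane function reading prescribed face values at the face centres of `δ𝕋`** (`δ ≠ 0`;
`hexCenter` is injective), with values in `[0, 1]` when the face values are. [folklore] -/
theorem exists_faceExtension (F : ℝ → Fin 3 → HexVertex → ℝ) (hF : ∀ δ i w, F δ i w ∈ Icc (0 : ℝ) 1) :
    ∃ f : ℝ → Fin 3 → ℂ → ℝ, (∀ δ, δ ≠ 0 → ∀ i w, f δ i ((δ : ℂ) * hexCenter w) = F δ i w) ∧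
      ∀ δ i c, f δ i c ∈ Icc (0 : ℝ) 1 := by
  classical
  refine ⟨fun δ i c => if h : ∃ w : HexVertex, c = (δ : ℂ) * hexCenter w then F δ i h.choose else 0,
    fun δ hδ i w => ?_, fun δ i c => ?_⟩
  · have h : ∃ w' : HexVertex, (δ : ℂ) * hexCenter w = (δ : ℂ) * hexCenter w' := ⟨w, rfl⟩
    simp only [dif_pos h]
    congr 1
    have hδ' : (δ : ℂ) ≠ 0 := by exact_mod_cast hδ
    exact (hexCenter_injective (mul_left_cancel₀ hδ' h.choose_spec)).symm
  · simp only
    split_ifs with h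
    · exact hF δ i _
    · exact ⟨le_rfl, zero_le_one⟩


/-! ### Separating data from approximate colour switching -/

/-- **Separating data of a discrete approximation from approximate colour switching**
(Bollobás–Riordan 2006, Ch. 7 §7.2.6 with Lemma 13 weakened to a colour-switching defect). Let
`G_δ` be a discrete approximation of the conformal rectangle `R`, `F δ i w ∈ [0, 1]` face values
and `g δ i w z` pair values with: (10) `F(z_j) - F(w) = g(w, z_j) - g(z_j, w)`; (12)
`|g(w, z_j)| ≤ ε_K(δ) → 0` and (14≈) `|g^{i+1}(w, z_{j+1}) - gⁱ(w, z_j)| ≤ η_K(δ) = o(δ)` for the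
faces with centre in a compact `K ⊆ Ω`, eventually; the estimate of p. 198 (for `β > 0` some
`γ > 0`: `F(z) - F(w) ≤ β` whenever `z` is reached from the triangle `w` of `G_δ` by a dual chain
of triangles of `G_δ` inside `B_{2γ}(w)`, eventually); and the boundary values of pp. 200–201.
Then the face centres of `G_δ` and a plane function `f` reading `F` at the face centres are
discrete separating data for `R` with `ω = ζ²`: `dense`/`interior` by (34) and the filling of
compacta, `equicontinuous` by p. 198 with Claim 21 (`local_conn`), `boundary` verbatim, and
`cauchy` by `norm_discreteTriangleIntegral_sub_mul_le_approx` — a contour in `K` has side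
`n δ ≤ diam Ω =: L`, so its defect `6 n δ ε_K + 3 n² δ η_K ≤ n δ (6 ε_K + 3 L η_K/δ)`, the rates
of the exhaustion `K_m` being dominated by one rate (`exists_rate_dominating`). -/
theorem exists_isSeparatingData_of_approxSwitching {R : ConformalRectangle}
    {G : ℝ → TriMarkedDomain 4} (hG : IsDiscreteApprox R G) (F : ℝ → Fin 3 → HexVertex → ℝ)
    (g : ℝ → Fin 3 → HexVertex → HexVertex → ℝ) (hF : ∀ δ i w, F δ i w ∈ Icc (0 : ℝ) 1)
    (h10 : ∀ δ, 0 < δ → ∀ (i : Fin 3) (w : HexVertex) (j : Fin 3),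
      F δ i (oppFace w j) - F δ i w = g δ i w (oppFace w j) - g δ i (oppFace w j) w)
    (h12 : ∀ K : Set ℂ, IsCompact K → K ⊆ R.carrier → ∃ ε : ℝ → ℝ, Tendsto ε (𝓝[>] 0) (𝓝 0) ∧
      ∀ᶠ δ : ℝ in 𝓝[>] 0, ∀ w : HexVertex, (δ : ℂ) * hexCenter w ∈ K →
        ∀ i j : Fin 3, |g δ i w (oppFace w j)| ≤ ε δ)
    (h14 : ∀ K : Set ℂ, IsCompact K → K ⊆ R.carrier → ∃ η : ℝ → ℝ,
      Tendsto (fun δ => η δ / δ) (𝓝[>] 0) (𝓝 0) ∧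
      ∀ᶠ δ : ℝ in 𝓝[>] 0, ∀ w : HexVertex, (δ : ℂ) * hexCenter w ∈ K →
        ∀ i j : Fin 3, |g δ (i + 1) w (oppFace w (j + 1)) - g δ i w (oppFace w j)| ≤ η δ)
    (h198 : ∀ β > (0 : ℝ), ∃ γ > (0 : ℝ), ∀ᶠ δ in 𝓝[>] (0 : ℝ), ∀ (i : Fin 3) (w z : HexVertex),
      w ∈ (G δ).faces → Relation.ReflTransGen (fun x y : HexVertex => hexGraph.Adj x y ∧
        y ∈ (G δ).faces ∧ dist ((δ : ℂ) * hexCenter w) ((δ : ℂ) * hexCenter y) < 2 * γ) w z →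
        F δ i z - F δ i w ≤ β)
    (h200 : ∀ (i : Fin 3), ∀ z ∈ (forgetLast R).boundary ''
        Ioo ((forgetLast R).mark i) ((forgetLast R).nextMark i),
      ∃ zs : ℝ → HexVertex,
        (∀ᶠ δ in 𝓝[>] (0 : ℝ), zs δ ∈ (G δ).faces ∧ (δ : ℂ) * hexCenter (zs δ) ∈ R.carrier) ∧
          Tendsto (fun δ : ℝ => (δ : ℂ) * hexCenter (zs δ)) (𝓝[>] 0) (𝓝 z) ∧
            Tendsto (fun δ => F δ i (zs δ)) (𝓝[>] 0) (𝓝 0) ∧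
              Tendsto (fun δ => F δ (i + 1) (zs δ) + F δ (i + 2) (zs δ)) (𝓝[>] 0) (𝓝 1)) :
    ∃ f : ℝ → Fin 3 → ℂ → ℝ, (∀ δ, δ ≠ 0 → ∀ i w, f δ i ((δ : ℂ) * hexCenter w) = F δ i w) ∧
      IsSeparatingData R triOmega (fun δ => ((G δ).faces).image fun w => (δ : ℂ) * hexCenter w) f := by
  obtain ⟨f, hf, hf01⟩ := exists_faceExtension F hF
  refine ⟨f, hf, ?_⟩
  -- a bound `L` for the diameter of `Ω`
  obtain ⟨r, hr⟩ := R.isBounded.subset_closedBall (0 : ℂ)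
  obtain ⟨L, hLpos, hdiam⟩ : ∃ L : ℝ, 0 < L ∧ ∀ u ∈ R.carrier, ∀ v ∈ R.carrier, dist u v ≤ L := by
    refine ⟨2 * |r| + 1, by positivity, fun u hu v hv => ?_⟩
    have hu' := hr hu
    have hv' := hr hv
    rw [mem_closedBall, dist_zero_right] at hu' hv'
    calc dist u v ≤ ‖u‖ + ‖v‖ := dist_le_norm_add_norm u v
      _ ≤ r + r := add_le_add hu' hv'
      _ ≤ 2 * |r| + 1 := by linarith [le_abs_self r]
  -- the exhaustion `K_m` of `Ω` and the per-level rates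
  obtain ⟨Km, hKm⟩ : ∃ Km : ℕ → Set ℂ, ∀ m, Km m = {z : ℂ | 1 / ((m : ℝ) + 1) ≤ infDist z R.carrierᶜ} :=
    ⟨_, fun _ => rfl⟩
  have hKc : ∀ m, IsCompact (Km m) ∧ Km m ⊆ R.carrier := fun m => by
    rw [hKm]; exact isCompact_deep R (by positivity)
  choose ε hε hεK using fun m => h12 (Km m) (hKc m).1 (hKc m).2
  choose η hη hηK using fun m => h14 (Km m) (hKc m).1 (hKc m).2
  obtain ⟨e, he⟩ : ∃ e : ℕ → ℝ → ℝ, ∀ m δ, e m δ = 6 * |ε m δ| + 3 * L * |η m δ / δ| :=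
    ⟨_, fun _ _ => rfl⟩
  have he0 : ∀ m, Tendsto (e m) (𝓝[>] 0) (𝓝 0) := by
    intro m
    have h1 := ((hε m).abs.const_mul 6).add ((hη m).abs.const_mul (3 * L))
    simp only [abs_zero, mul_zero, add_zero] at h1
    exact h1.congr fun δ => (he m δ).symm
  obtain ⟨E, hE, hEe⟩ := exists_rate_dominating e he0
  exact
  { mem_Icc := fun δ i w _ => hf01 δ i w
    dense := by
      obtain ⟨ε', hε', h⟩ := hG.dense
      refine ⟨ε', hε', h.mono fun δ hδ z hz => ?_⟩
      obtain ⟨w, hw, hd⟩ := hδ z hz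
      exact ⟨_, Finset.mem_image_of_mem _ hw, hd⟩
    interior := fun K hK hKΩ => by
      obtain ⟨κ, hκ, hK'⟩ := hK.exists_cthickening_subset_open R.isOpen hKΩ
      have hfill := hG.fill (cthickening κ K) hK.cthickening hK'
      have hsmall : ∀ᶠ δ in 𝓝[>] (0 : ℝ), δ ∈ Ioc 0 κ := Ioc_mem_nhdsGT hκ
      filter_upwards [hfill, hsmall] with δ hfill hδ x hxK
      refine Finset.mem_image_of_mem _ (((G δ).mem_faces).2 fun v hv => hfill v ?_)
      refine mem_cthickening_of_dist_le _ _ _ _ hxK ?_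
      exact (dist_triMeshPoint_hexCenter_le hv δ).trans (by rw [abs_of_pos hδ.1]; exact hδ.2)
    equicontinuous := fun β hβ => by
      obtain ⟨γ, hγ, h198'⟩ := h198 β hβ
      obtain ⟨θ, hθ, hloc⟩ := hG.local_conn γ hγ
      refine ⟨θ, hθ, ?_⟩
      filter_upwards [hloc, h198', self_mem_nhdsWithin] with δ hloc h198' hδ i z hz w hw hzw
      obtain ⟨Z, hZ, rfl⟩ := Finset.mem_image.1 hz
      obtain ⟨W, hW, rfl⟩ := Finset.mem_image.1 hw
      have hδ0 : δ ≠ 0 := ne_of_gt hδ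
      rw [hf δ hδ0, hf δ hδ0]
      exact h198' i W Z hW (hloc W hW Z hZ (by rw [dist_comm]; exact hzw))
    cauchy := by
      refine ⟨E, hE, fun K hK hKΩ => ?_⟩
      obtain ⟨m, hm⟩ := exists_subset_deep R hK hKΩ
      rw [← hKm] at hm
      filter_upwards [hεK m, hηK m, hEe m, self_mem_nhdsWithin] with δ h12' h14' hEδ hδ i x₀ n s hs hT
      have hδpos : 0 < δ := hδ
      have hδ0 : δ ≠ 0 := ne_of_gt hδpos
      have key := norm_discreteTriangleIntegral_sub_mul_le_approx hδpos.le x₀ n hs (f δ) (g δ)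
        (ε := |ε m δ|) (η := |η m δ|) (hT.trans hm)
        (fun w hw i j => (h14' w hw i j).trans (le_abs_self _))
        (fun w _ j _ i => by rw [hf δ hδ0, hf δ hδ0]; exact h10 δ hδpos i w j)
        (fun w hw i j => (h12' w hw i j).trans (le_abs_self _)) i
      -- the side of the contour is at most the diameter of `Ω`
      have hnδ : (n : ℝ) * δ ≤ L := by
        have hp : triMeshPoint δ x₀ ∈ R.carrier :=
          hKΩ (hT (subset_convexHull ℝ _ (by simp)))
        have hq : triMeshPoint δ x₀ + n * s ∈ R.carrier :=
          hKΩ (hT (subset_convexHull ℝ _ (by simp)))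
        have h := hdiam _ hp _ hq
        rw [dist_eq_norm, sub_add_cancel_left, norm_neg] at h
        have hns : ‖((n : ℂ) * (s : ℂ))‖ = n * δ := by
          rw [norm_mul, Complex.norm_natCast, Complex.norm_real, Real.norm_eq_abs]
          rcases hs with rfl | rfl
          · rw [abs_of_pos hδpos]
          · rw [abs_neg, abs_of_pos hδpos]
        rw [hns] at h
        exact h
      have hrate : 6 * n * δ * |ε m δ| + 3 * n ^ 2 * δ * |η m δ| ≤ n * δ * e m δ := by
        have h1 : |η m δ| = δ * |η m δ / δ| := by
          rw [abs_div, abs_of_pos hδpos, mul_div_cancel₀ _ hδ0]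
        rw [he, h1]
        have hn0 : (0 : ℝ) ≤ n := n.cast_nonneg
        have ha : 0 ≤ |η m δ / δ| := abs_nonneg _
        have hb : 0 ≤ |ε m δ| := abs_nonneg _
        nlinarith [mul_le_mul_of_nonneg_right hnδ (mul_nonneg (mul_nonneg hn0 hδpos.le) ha)]
      calc _ ≤ 6 * n * δ * |ε m δ| + 3 * n ^ 2 * δ * |η m δ| := key
        _ ≤ n * δ * e m δ := hrate
        _ ≤ n * δ * E δ := mul_le_mul_of_nonneg_left hEδ (mul_nonneg n.cast_nonneg hδpos.le)
    boundary := fun i z hz => by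
      obtain ⟨zs, hzs, hzt, hf0, hf1⟩ := h200 i z hz
      have hpos : ∀ᶠ δ in 𝓝[>] (0 : ℝ), δ ≠ 0 :=
        (eventually_mem_nhdsWithin).mono fun δ hδ => ne_of_gt hδ
      refine ⟨fun δ => (δ : ℂ) * hexCenter (zs δ), hzs.mono fun δ hδ =>
        ⟨Finset.mem_image_of_mem _ hδ.1, hδ.2⟩, hzt, ?_, ?_⟩
      · exact hf0.congr' (hpos.mono fun δ hδ => (hf δ hδ i (zs δ)).symm)
      · refine hf1.congr' (hpos.mono fun δ hδ => ?_)
        beta_reduce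
        rw [hf δ hδ, hf δ hδ] }


end Summit.CriticalPhenomena.CardyFormulaZ2.Theorems

end
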